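import Literature.Probability.Distributions.BrascampLiebFibre
import HarnessLib

/-!
# The cube `[-S,S]^n` for the Brascamp–Lieb induction: Fubini along `Fin.cons`, fibre integrals

`Literature/Probability/Distributions/`. Measure-theoretic glue for the cube-induction proof of
the Brascamp–Lieb variance inequality (`BrascampLieb1976_thm41`, file `BrascampLieb`):

* the cube `[-S,S]^n ⊂ ℝⁿ` (`Set.pi univ fun _ => Icc (-S) S`): compact, measurable, positive and
  finite volume; continuous functions are integrable on it; positive continuous functions have
  positive integral (`setIntegral_cube_pos`);
* Fubini along the first coordinate (`setIntegral_cube_succ`):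
  `∫_{[-S,S]^{m+1}} φ = ∫_{[-S,S]} ∫_{[-S,S]^m} φ(y, z) dz dy`, from
  `volume_preserving_piFinSuccAbove`;
* fibre integrals `y ↦ ∫_{[-S,S]^m} ψ(y, z) dz` of continuous `ψ`: continuity
  (`continuous_fibreIntegral`) and differentiation under the integral sign
  (`hasDerivAt_fibreIntegral`, dominated by a constant on the compact cube) — this is where
  working on compact cubes pays: no uniform-convergence hypotheses (Brascamp–Lieb's (4.6)) arise;
* the `y`-derivatives of `e^{-f(y,z)}`, `∂₀f(y,z)`, `h(y,z)` and the Schur positivity along a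
  fibre (`schur_fibre_pos`).

No definitions.
-/

noncomputable section

open Matrix MeasureTheory Set Filter Function
open scoped Topology

namespace Literature.Probability.Distributions


variable {m : ℕ}

/-! ### The cube `[-S, S]^m` -/

/-- The cube `[-S,S]^m` is compact. [folklore] -/
theorem isCompact_cube (m : ℕ) (S : ℝ) :
    IsCompact (Set.pi Set.univ fun (_ : Fin m) => Set.Icc (-S) S) :=
  isCompact_univ_pi fun _ => isCompact_Icc

/-- The cube `[-S,S]^m` is measurable. [folklore] -/
theorem measurableSet_cube (m : ℕ) (S : ℝ) :
    MeasurableSet (Set.pi Set.univ fun (_ : Fin m) => Set.Icc (-S) S) :=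
  (isCompact_cube m S).isClosed.measurableSet

/-- The cube `[-S,S]^m` has positive volume for `S > 0`. [folklore] -/
theorem volume_cube_pos (m : ℕ) {S : ℝ} (hS : 0 < S) :
    0 < volume (Set.pi Set.univ fun (_ : Fin m) => Set.Icc (-S) S) := by
  rw [Set.pi_univ_Icc, Real.volume_Icc_pi]
  refine pos_iff_ne_zero.2 (Finset.prod_ne_zero_iff.2 fun i _ => ?_)
  exact (ENNReal.ofReal_pos.2 (by simp only [sub_neg_eq_add]; linarith)).ne'

/-- The cube `[-S,S]^m` has finite volume. [folklore] -/
theorem volume_cube_lt_top (m : ℕ) (S : ℝ) :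
    volume (Set.pi Set.univ fun (_ : Fin m) => Set.Icc (-S) S) < ⊤ :=
  (isCompact_cube m S).measure_lt_top

/-- A continuous function is integrable on the cube. [folklore] -/
theorem integrableOn_cube {ψ : (Fin m → ℝ) → ℝ} (hψ : Continuous ψ) (S : ℝ) :
    IntegrableOn ψ (Set.pi Set.univ fun (_ : Fin m) => Set.Icc (-S) S) volume :=
  hψ.continuousOn.integrableOn_compact (isCompact_cube m S)

/-- The integral over the cube of a continuous positive function is positive (`S > 0`).
[folklore] -/
theorem setIntegral_cube_pos {ψ : (Fin m → ℝ) → ℝ} (hψ : Continuous ψ) (hpos : ∀ z, 0 < ψ z)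
    {S : ℝ} (hS : 0 < S) :
    0 < ∫ z in Set.pi Set.univ (fun (_ : Fin m) => Set.Icc (-S) S), ψ z := by
  rw [setIntegral_pos_iff_support_of_nonneg_ae (Eventually.of_forall fun z => (hpos z).le)
    (integrableOn_cube hψ S)]
  have : support ψ = univ := by
    ext z; simp [(hpos z).ne']
  rw [this, univ_inter]
  exact volume_cube_pos m hS

/-! ### Splitting the cube `[-S,S]^{m+1} = [-S,S] × [-S,S]^m` (Fubini along `Fin.cons`) -/

/-- `(y, z) ∈ [-S,S]^{m+1} ↔ y ∈ [-S,S] ∧ z ∈ [-S,S]^m`. [folklore] -/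
theorem cons_mem_cube_iff {S : ℝ} {y : ℝ} {z : Fin m → ℝ} :
    (Fin.cons y z : Fin (m + 1) → ℝ) ∈ Set.pi Set.univ (fun (_ : Fin (m + 1)) => Set.Icc (-S) S) ↔
      y ∈ Set.Icc (-S) S ∧ z ∈ Set.pi Set.univ (fun (_ : Fin m) => Set.Icc (-S) S) := by
  simp only [mem_univ_pi, Fin.forall_fin_succ, Fin.cons_zero, Fin.cons_succ]

/-- **Fubini along the first coordinate** for a continuous function on the cube:
`∫_{[-S,S]^{m+1}} φ = ∫_{[-S,S]} ∫_{[-S,S]^m} φ(y, z) dz dy`. [folklore] -/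
theorem setIntegral_cube_succ (S : ℝ) {φ : (Fin (m + 1) → ℝ) → ℝ} (hφ : Continuous φ) :
    ∫ x in Set.pi Set.univ (fun (_ : Fin (m + 1)) => Set.Icc (-S) S), φ x =
      ∫ y in Set.Icc (-S) S, ∫ z in Set.pi Set.univ (fun (_ : Fin m) => Set.Icc (-S) S),
        φ (Fin.cons y z) := by
  set e := MeasurableEquiv.piFinSuccAbove (fun _ : Fin (m + 1) => ℝ) 0 with he
  have hmp : MeasurePreserving e volume ((volume : Measure ℝ).prod (volume : Measure (Fin m → ℝ))) :=
    volume_preserving_piFinSuccAbove (fun _ : Fin (m + 1) => ℝ) 0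
  have hsymm_apply : ∀ p : ℝ × (Fin m → ℝ), e.symm p = Fin.cons p.1 p.2 := fun p => by
    simp [he, MeasurableEquiv.piFinSuccAbove_symm_apply, Fin.insertNthEquiv, Fin.insertNth_zero']
  have hpre : e.symm ⁻¹' (Set.pi Set.univ (fun (_ : Fin (m + 1)) => Set.Icc (-S) S)) =
      (Set.Icc (-S) S) ×ˢ (Set.pi Set.univ (fun (_ : Fin m) => Set.Icc (-S) S)) := by
    ext ⟨y, z⟩
    rw [mem_preimage, hsymm_apply, cons_mem_cube_iff, mem_prod]
  have h1 := hmp.symm.setIntegral_preimage_emb e.symm.measurableEmbedding φ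
    (Set.pi Set.univ (fun (_ : Fin (m + 1)) => Set.Icc (-S) S))
  rw [← h1, hpre]
  have hint : IntegrableOn (fun p : ℝ × (Fin m → ℝ) => φ (e.symm p))
      ((Set.Icc (-S) S) ×ˢ (Set.pi Set.univ (fun (_ : Fin m) => Set.Icc (-S) S)))
      ((volume : Measure ℝ).prod (volume : Measure (Fin m → ℝ))) := by
    rw [← hpre]
    exact (hmp.symm.integrableOn_comp_preimage e.symm.measurableEmbedding).2
      (integrableOn_cube hφ S)
  rw [setIntegral_prod _ hint]
  simp only [hsymm_apply]

/-! ### Parametric fibre integrals: continuity and differentiation under the integral sign -/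

/-- Continuity of a fibre integral `y ↦ ∫_{[-S,S]^m} ψ(y, z) dz` for continuous `ψ`.
[folklore] -/
theorem continuous_fibreIntegral (S : ℝ) {ψ : (Fin (m + 1) → ℝ) → ℝ} (hψ : Continuous ψ) :
    Continuous fun y : ℝ =>
      ∫ z in Set.pi Set.univ (fun (_ : Fin m) => Set.Icc (-S) S), ψ (Fin.cons y z) :=
  continuous_parametric_integral_of_continuous
    (f := fun (y : ℝ) (z : Fin m → ℝ) => ψ (Fin.cons y z))
    (hψ.comp continuous_cons_uncurry) (isCompact_cube m S)

/-- Differentiation under the integral sign for a fibre integral over the compact cube: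
if `d/dy ψ(y,z) = ψ'(y,z)` with `ψ, ψ'` continuous then
`d/dy ∫ ψ(y,z) dz = ∫ ψ'(y,z) dz`. [folklore] -/
theorem hasDerivAt_fibreIntegral (S : ℝ) {ψ ψ' : (Fin (m + 1) → ℝ) → ℝ} (hψ : Continuous ψ)
    (hψ' : Continuous ψ')
    (hder : ∀ (y : ℝ) (z : Fin m → ℝ),
      HasDerivAt (fun y : ℝ => ψ (Fin.cons y z)) (ψ' (Fin.cons y z)) y)
    (y₀ : ℝ) :
    HasDerivAt (fun y : ℝ =>
        ∫ z in Set.pi Set.univ (fun (_ : Fin m) => Set.Icc (-S) S), ψ (Fin.cons y z))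
      (∫ z in Set.pi Set.univ (fun (_ : Fin m) => Set.Icc (-S) S), ψ' (Fin.cons y₀ z)) y₀ := by
  set K := Set.pi Set.univ (fun (_ : Fin m) => Set.Icc (-S) S) with hK
  have hKc : IsCompact K := isCompact_cube m S
  haveI : IsFiniteMeasure (volume.restrict K) := ⟨by
    rw [Measure.restrict_apply_univ]; exact volume_cube_lt_top m S⟩
  have hc1 : Continuous (fun p : ℝ × (Fin m → ℝ) => ψ (Fin.cons p.1 p.2)) :=
    hψ.comp continuous_cons_uncurry
  have hc2 : Continuous (fun p : ℝ × (Fin m → ℝ) => ψ' (Fin.cons p.1 p.2)) :=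
    hψ'.comp continuous_cons_uncurry
  obtain ⟨C, hC⟩ := (isCompact_Icc.prod hKc).exists_bound_of_continuousOn
    (s := Set.Icc (y₀ - 1) (y₀ + 1) ×ˢ K) hc2.continuousOn
  have key := hasDerivAt_integral_of_dominated_loc_of_deriv_le
    (μ := volume.restrict K) (F := fun (y : ℝ) (z : Fin m → ℝ) => ψ (Fin.cons y z))
    (F' := fun (y : ℝ) (z : Fin m → ℝ) => ψ' (Fin.cons y z)) (x₀ := y₀)
    (s := Set.Icc (y₀ - 1) (y₀ + 1)) (bound := fun _ => C)
    (Icc_mem_nhds (by linarith) (by linarith))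
    (Eventually.of_forall fun y =>
      (hc1.comp (Continuous.prodMk_right y)).aestronglyMeasurable)
    ((hc1.comp (Continuous.prodMk_right y₀)).continuousOn.integrableOn_compact hKc)
    ((hc2.comp (Continuous.prodMk_right y₀)).aestronglyMeasurable)
    (ae_restrict_of_forall_mem (measurableSet_cube m S) fun z hz y hy =>
      hC (y, z) ⟨hy, hz⟩)
    (integrable_const C)
    (Eventually.of_forall fun z y _ => hder y z)
  exact key.2

/-! ### Fibre toolkit -/

/-- `z ↦ (y, z)` is continuous. [folklore] -/
theorem continuous_cons_right (y : ℝ) :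
    Continuous fun z : Fin m → ℝ => (Fin.cons y z : Fin (m + 1) → ℝ) :=
  continuous_cons_uncurry.comp (Continuous.prodMk_right y)

/-- A continuous function restricted to a fibre is integrable on the cube. [folklore] -/
theorem integrableOn_fibre {ψ : (Fin (m + 1) → ℝ) → ℝ} (hψ : Continuous ψ) (S y : ℝ) :
    IntegrableOn (fun z : Fin m → ℝ => ψ (Fin.cons y z))
      (Set.pi Set.univ fun (_ : Fin m) => Set.Icc (-S) S) volume :=
  integrableOn_cube (hψ.comp (continuous_cons_right y)) S

/-- `exp (-f)` is continuous for continuous `f`. [folklore] -/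
theorem continuous_expNeg {n : ℕ} {f : (Fin n → ℝ) → ℝ} (hf : Continuous f) :
    Continuous fun x => Real.exp (-f x) :=
  Real.continuous_exp.comp hf.neg

/-- `d/dy e^{-f(y,z)} = -∂₀f(y,z) e^{-f(y,z)}`. [folklore] -/
theorem hasDerivAt_expNeg_cons {f : (Fin (m + 1) → ℝ) → ℝ} (hf : ContDiff ℝ 2 f) (y : ℝ)
    (z : Fin m → ℝ) :
    HasDerivAt (fun y : ℝ => Real.exp (-f (Fin.cons y z)))
      (-(fderiv ℝ f (Fin.cons y z) (Pi.single 0 1) * Real.exp (-f (Fin.cons y z)))) y := by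
  have h1 := hasDerivAt_comp_cons_left (z := z) ((hf.differentiable two_ne_zero) (Fin.cons y z))
  exact (h1.neg.exp).congr_deriv (by simp only [Pi.neg_apply]; ring)

/-- `d/dy ∂₀f(y,z) = f₀₀(y,z)`. [folklore] -/
theorem hasDerivAt_fderiv0_cons {f : (Fin (m + 1) → ℝ) → ℝ} (hf : ContDiff ℝ 2 f) (y : ℝ)
    (z : Fin m → ℝ) :
    HasDerivAt (fun y : ℝ => fderiv ℝ f (Fin.cons y z) (Pi.single 0 1))
      (coordHessian f (Fin.cons y z) 0 0) y :=
  hasDerivAt_comp_cons_left (F := fun x => fderiv ℝ f x (Pi.single 0 1))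
    (((contDiff_one_fderiv_apply hf _).differentiable one_ne_zero) _)

/-- `d/dy h(y,z) = ∂₀h(y,z)`. [folklore] -/
theorem hasDerivAt_cons_of_contDiff {h : (Fin (m + 1) → ℝ) → ℝ} (hh : ContDiff ℝ 1 h) (y : ℝ)
    (z : Fin m → ℝ) :
    HasDerivAt (fun y : ℝ => h (Fin.cons y z)) (fderiv ℝ h (Fin.cons y z) (Pi.single 0 1)) y :=
  hasDerivAt_comp_cons_left ((hh.differentiable one_ne_zero) _)

/-- The Schur scalar along a fibre: `f₀₀ − (∇_z ∂₀f)ᵀ f_zz⁻¹ (∇_z ∂₀f) > 0`. [folklore] -/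
theorem schur_fibre_pos {f : (Fin (m + 1) → ℝ) → ℝ} (hf : ContDiff ℝ 2 f)
    (hpd : ∀ x, (coordHessian f x).PosDef) (y : ℝ) (z : Fin m → ℝ) :
    0 < coordHessian f (Fin.cons y z) 0 0 -
      coordGradient (fun z : Fin m → ℝ => fderiv ℝ f (Fin.cons y z) (Pi.single 0 1)) z ⬝ᵥ
        ((coordHessian (fun z : Fin m → ℝ => f (Fin.cons y z)) z)⁻¹ *ᵥ
          coordGradient (fun z : Fin m → ℝ => fderiv ℝ f (Fin.cons y z) (Pi.single 0 1)) z) := by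
  have hMpd : (coordHessian f (Fin.cons y z)).PosDef := hpd _
  have hsymm : ∀ i : Fin m, coordHessian f (Fin.cons y z) i.succ 0 =
      coordHessian f (Fin.cons y z) 0 i.succ := fun i => by
    have e := hMpd.isHermitian.apply i.succ 0
    rw [star_trivial] at e
    exact e.symm
  have hf0 : ContDiff ℝ 1 (fun x => fderiv ℝ f x (Pi.single 0 1)) :=
    contDiff_one_fderiv_apply hf _
  have hgrad : coordGradient (fun z : Fin m → ℝ => fderiv ℝ f (Fin.cons y z) (Pi.single 0 1)) z =
      fun i => coordHessian f (Fin.cons y z) 0 i.succ := by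
    rw [coordGradient_comp_cons (h := fun x => fderiv ℝ f x (Pi.single 0 1))
        ((hf0.differentiable one_ne_zero) _)]
    funext i
    rw [← hsymm i]
    rfl
  rw [hgrad, coordHessian_comp_cons hf]
  exact schur_scalar_pos hMpd

end Literature.Probability.Distributions
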